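import Literature.AnabelianGeometry.EtaleTheta.Discharge.Sec5Thm57JunctionJ2OfRigidData
import Literature.AnabelianGeometry.EtaleTheta.FrobenioidCyclotomicRigidityProjGalois

/-!
# [EtTh] §5, Theorem 5.7 (C)-junction token (J2η) over a §2 `RigidData` — RE-KEYED ON THE v2 SUBQUOTIENT RECORD
# `ThetaSubquotientProjGalois 𝔉 Gal` (surjectivity at Galois objects only) — PROOF-ONLY, proofs verbatim

Mochizuki, *The étale theta function and its Frobenioid-theoretic manifestations*, Publ. RIMS **45** (2009)
[cite: MochizukiEtTh2009, Thm 5.7 proof p.330 (PDF p.104); Thm 5.6 proof p.329 (PDF p.103); Prop 1.3 / §2 p.46; Cor 2.18 (i) p.60;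
Prop 5.2 (iii) p.324 (PDF p.98); §5 p.327 (PDF p.101) «these subquotients determine subquotients `Aut_D(D) ↠ Aut^Θ_D(D)`»].
abc-iut cell, layer L2, seat abc-iut-w5-d051 (gen 6), row «(w4) V1→V2 MECHANICAL PORT — TRANCHE 2 = THM 5.7 (C)-JUNCTION HEADS», file 2/3
(abc-iut-L2-lead gen 7, VNEXT-CENSUS-L2 §G5 add. 11 standing row «(w4)»).

WHY.  abc-iut-L2-t9's `Discharge/Sec5Thm57JunctionJ2OfRigidData.lean` (imported above; p462571) proves the (C)-junction token
(J2η) «`γ_Δ` IS `γ` on the theta classes of the Δ-part» — `∀ k ∈ Π^tp_Ÿ̲, ρ k ∈ P.pre → γ_Δ(η(ι k)) = η(γ(ι k))` — generically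
(`gammaDelta_eta_of_lift`) and at abc-iut-L2-t4's genuine level-`N` data `ofConnectedTemperoidData …` for `γ_Δ := φΛ`
(`hlift_levelStub_of_pin`, `gammaDelta_eta_levelStub_of_pin`), over a binder `P : ThetaSubquotientProj 𝔉` — abc-iut-L2-t4's v1 record,
which asks `P_E ↠ (l·Δ_Θ)_E` at EVERY base object and is EMPTY at the cell's root model for `l` odd (p456572, p476337: rigid non-Galois
objects obstruct).  abc-iut-w6-d079's v2 record `FrobenioidCyclotomicRigidity.ThetaSubquotientProjGalois 𝔉 Gal` (p481123; onto only at the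
objects singled out by `Gal : D → Prop`, as print uses it) is INHABITED at the carriers of record (p481568, p485626).  The three theorems read
`P` only through `P.pre` (never `proj_surjective`), so they re-key by a binder-type change.

THIS FILE: `gammaDelta_eta_of_lift_galois` (`{Gal : D → Prop} {P : ThetaSubquotientProjGalois 𝔉 Gal}`), `hlift_levelStub_of_pin_galois` and
`gammaDelta_eta_levelStub_of_pin_galois` (`{Gal : ConnectedPart (BTemp X.Pi) → Prop}`, `P : ThetaSubquotientProjGalois (ofConnectedTemperoidData …) Gal`)
— statements otherwise and proofs VERBATIM; the `P`-free (γL) lemmas of the source (`RigidData.thetaMod_transport_of_descent` /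
`…_of_cor218i` / `symm_apply_apply_mem_PiYdd_of_cor218i`), abc-iut-L2-d4's fibre constancy `eta_apply_eq_of_rho_eq` (p453757) and
abc-iut-w4-d042's hlift shape `ThetaSubquotient.exists_lift_of_rho_mem_autPre` are used BY NAME.  0 `def`s, nothing landed is edited.
Companion of my `Sec5Thm57JunctionHK4OfK4Galois.lean` (file 1/3: the heads `psiAut_symm_eq_of_rigidity_galois` /
`kummerComparison_of_thetaSectionCompat_of_rigidity_galois` whose hypothesis `hγΔ` these theorems produce VERBATIM).
HONEST FRAMING: a typing repair of the cell's OWN record (weaker quantifier, as print uses it); kernel-checked implications between typed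
statements; the existence of the pinned `P`, of the descent data and of the shadow-normalised `γ` is NOT asserted; [EtTh] is refereed;
typed ≠ discharged; no side taken on [IUTchIII] Cor. 3.12; nothing here asserts abc proved or refuted.
-/

noncomputable section

namespace Literature.AnabelianGeometry.EtaleTheta

open CategoryTheory Opposite FrobenioidCyclotomicRigidity Literature.AlgebraicGeometry.Frobenioids
  Literature.AnabelianGeometry.SemiGraphs Literature.AnabelianGeometry.SemiGraphs.GaloisObjects
open Literature.AlgebraicGeometry.Frobenioids.QuasiTemperoid (stabilizerSubgroup)

universe w v v' u u' uR vG u₀ v₀ w'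

namespace ThetaFrobenioid

/-! ### (J2η), generic — on the v2 record -/

section Generic

variable {C : Type u} [Category.{v} C] {D : Type u'} [Category.{v'} D] {𝔉 : ThetaFrobenioid.{w} C D}

/-- **(J2η) from the pin, `η` tautological on `l·Δ_Θ`, the hlift law, the shadow law and (γL)** — see the module docstring.  Conclusion: VERBATIM
the hypothesis `hγΔ` of `psiAut_symm_eq_of_rigidity` / `kummerComparison_of_thetaSectionCompat_of_rigidity` (p458989) at `T := RD.toThetaEnvData`.
[cite: MochizukiEtTh2009, Thm 5.7 proof p.330 (PDF p.104); §2 p.46; Prop 5.2 (iii) p.324 (PDF p.98)] -/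
theorem gammaDelta_eta_of_lift_galois (H : 𝔉.Facts) {l' : ℕ} (RD : RigidData.{v} 𝔉.N l') (ι : 𝔉.PiX ≃* RD.PiX)
    (m : 𝔉.muTorsion 𝔉.BN 𝔉.N ≃* RD.mu) (hι : 𝔉.IdentifiesPiYdd RD.toThetaEnvData ι) {η : RD.PiYdd → RD.mu}
    (hη : η ∈ RD.thetaCocycles) (hpin : 𝔉.ThetaSectionCompat H RD.toThetaEnvData ι m hι η)
    {Gal : D → Prop} {P : ThetaSubquotientProjGalois 𝔉 Gal}
    (hlift : ∀ k : 𝔉.PiYdd, 𝔉.ρ k ∈ P.pre (𝔉.base.obj 𝔉.BN) →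
      ∃ k₁ : 𝔉.PiYdd, (ι k₁ : RD.PiX) ∈ RD.lDeltaTheta ∧ 𝔉.ρ k₁ = 𝔉.ρ k)
    (θ : Aut (𝔉.base.obj 𝔉.BN) ≃* Aut (𝔉.base.obj 𝔉.BN)) (γ : RD.PiX → RD.PiX)
    (hγ : ∀ x : RD.PiX, x ∈ RD.PiYdd → γ x ∈ RD.PiYdd)
    (hshadow : ∀ k : 𝔉.PiYdd, θ (𝔉.ρ k) = 𝔉.ρ (ι.symm (γ (ι k)))) (γΔ : RD.mu → RD.mu)
    (hγL : ∀ (g : RD.PiX) (hg : g ∈ RD.lDeltaTheta),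
      ∃ hγg : γ g ∈ RD.lDeltaTheta, RD.thetaMod ⟨γ g, hγg⟩ = γΔ (RD.thetaMod ⟨g, hg⟩)) :
    ∀ k : 𝔉.PiYdd, 𝔉.ρ k ∈ P.pre (𝔉.base.obj 𝔉.BN) →
      γΔ (η ⟨ι k, (hι k).mp k.2⟩) = η ⟨γ (ι k), hγ _ ((hι k).mp k.2)⟩ := by
  intro k hk
  obtain ⟨k₁, hk₁, hρ⟩ := hlift k hk
  -- (a) `η(ι k) = η(ι k₁) = thetaMod(ι k₁)`
  have e1 : η ⟨ι k, (hι k).mp k.2⟩ = η ⟨ι k₁, (hι k₁).mp k₁.2⟩ :=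
    eta_apply_eq_of_rho_eq H RD.toThetaEnvData ι m hι hpin hρ.symm
  have e2 : η ⟨ι k₁, (hι k₁).mp k₁.2⟩ = RD.thetaMod ⟨ι k₁, hk₁⟩ :=
    RD.cocycle_lDeltaTheta η hη ⟨ι k₁, (hι k₁).mp k₁.2⟩ hk₁
  obtain ⟨hγg, e3⟩ := hγL (ι k₁) hk₁
  have e4 : η ⟨γ (ι k₁), hγ _ ((hι k₁).mp k₁.2)⟩ = RD.thetaMod ⟨γ (ι k₁), hγg⟩ :=
    RD.cocycle_lDeltaTheta η hη ⟨γ (ι k₁), hγ _ ((hι k₁).mp k₁.2)⟩ hγg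
  -- (b) the `θ`-translates of `k`, `k₁` lie in one `ρ`-fibre, so `η(γ ι k) = η(γ ι k₁)`
  have hmem : ∀ k : 𝔉.PiYdd, ι.symm (γ (ι k)) ∈ 𝔉.PiYdd := fun k =>
    (hι _).mpr (by rw [MulEquiv.apply_symm_apply]; exact hγ _ ((hι k).mp k.2))
  have e5 : η ⟨ι ((⟨ι.symm (γ (ι k)), hmem k⟩ : 𝔉.PiYdd) : 𝔉.PiX), (hι _).mp (hmem k)⟩ =
      η ⟨ι ((⟨ι.symm (γ (ι k₁)), hmem k₁⟩ : 𝔉.PiYdd) : 𝔉.PiX), (hι _).mp (hmem k₁)⟩ :=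
    eta_apply_eq_of_rho_eq H RD.toThetaEnvData ι m hι hpin (k := ⟨ι.symm (γ (ι k)), hmem k⟩)
      (k' := ⟨ι.symm (γ (ι k₁)), hmem k₁⟩)
      (by
        change 𝔉.ρ (ι.symm (γ (ι k))) = 𝔉.ρ (ι.symm (γ (ι k₁)))
        rw [← hshadow k, ← hshadow k₁, hρ])
  have ek : (⟨γ (ι k), hγ _ ((hι k).mp k.2)⟩ : RD.PiYdd) =
      ⟨ι ((⟨ι.symm (γ (ι k)), hmem k⟩ : 𝔉.PiYdd) : 𝔉.PiX), (hι _).mp (hmem k)⟩ :=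
    Subtype.ext (MulEquiv.apply_symm_apply ι _).symm
  have ek₁ : (⟨γ (ι k₁), hγ _ ((hι k₁).mp k₁.2)⟩ : RD.PiYdd) =
      ⟨ι ((⟨ι.symm (γ (ι k₁)), hmem k₁⟩ : 𝔉.PiYdd) : 𝔉.PiX), (hι _).mp (hmem k₁)⟩ :=
    Subtype.ext (MulEquiv.apply_symm_apply ι _).symm
  rw [e1, e2, ← e3, ← e4, ek₁, ← e5, ← ek]

end Generic

/-! ### (J2η) at the genuine level-`N` data — on the v2 record -/

section LevelN

variable {K : Type u₀} [Field K] {X : SemiGraphs.TemperedArithmeticGroup.{u₀} K} {D₀ : Type u₀} [Category.{v₀} D₀]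
  {V : FrdIMonoidStub.{max u₀ w'}} {T₀ : RealifiedDivisorMonoids (D₀ := D₀) V}
  {VD : FrdICatStub.{u₀ + 1, u₀, max u₀ w'} (ConnectedPart (BTemp X.Pi))}
  {tf : TemperedFrobenioid T₀ (ConnectedPart (BTemp X.Pi)) VD} {hZ : tf.monoidType = MonoidType.Z}
  {hP : ∀ A : (ConnectedPart (BTemp X.Pi))ᵒᵖ, IsPerfect (tf.Φ.carrier A)}
  {NH : Subgroup (Field.absoluteGaloisGroup K) → tf.category → ℕ+ → Prop} {A₀ : tf.category}
  {hA₀ : PreFrobenioid.IsFrobeniusTrivial tf.toElem A₀} {hA₀' : SemiGraphs.IsGaloisObj A₀.base.obj}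
  {lv N : ℕ+} {l' : ℕ} {RD : RigidData.{max u₀ w'} N l'}
  {pullFrac : ∀ {A A' : (BiKummerSetting.mkOfConnectedTemperoid X tf hZ hP NH A₀ hA₀ hA₀').C} (_ : A' ⟶ A),
    (BiKummerSetting.mkOfConnectedTemperoid X tf hZ hP NH A₀ hA₀ hA₀').biratUnits A →
      (BiKummerSetting.mkOfConnectedTemperoid X tf hZ hP NH A₀ hA₀ hA₀').biratUnits A'}
  {θ : (BiKummerSetting.mkOfConnectedTemperoid X tf hZ hP NH A₀ hA₀ hA₀').biratUnits
    (BiKummerSetting.mkOfConnectedTemperoid X tf hZ hP NH A₀ hA₀ hA₀').Aodot}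
  {Bl : (BiKummerSetting.mkOfConnectedTemperoid X tf hZ hP NH A₀ hA₀ hA₀').C}
  {Pl : (BiKummerSetting.mkOfConnectedTemperoid X tf hZ hP NH A₀ hA₀ hA₀').FractionPair θ Bl}
  {Rl : (BiKummerSetting.mkOfConnectedTemperoid X tf hZ hP NH A₀ hA₀ hA₀').NthRoot θ Pl lv pullFrac}
  (h : ModelFrobenioid.Hypotheses tf.divisorMonoid tf.ratFnFunctor)
  (odd_l : Odd (lv : ℕ))
  (R : (BiKummerSetting.mkOfConnectedTemperoid X tf hZ hP NH A₀ hA₀ hA₀').NthRoot Rl.root Rl.pair N pullFrac)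
  (ιX : RD.PiX ≃ₜ* X.Pi) (K' : Type (max u₀ w')) [Field K'] (constEmb : K'ˣ →* tf.biratUnitsModel R.BN)
  (constEmb_injective : Function.Injective constEmb)
  (hinvc : ∀ g : Aut R.AN.base,
    pull tf.divisorMonoid g.hom (ModelFrobenioid.div R.pair.num) = ModelFrobenioid.div R.pair.num)
  (hinvp : ∀ y : RD.PiX, y ∈ RD.PiYdd →
    pull tf.divisorMonoid ((BiKummerSetting.mkOfConnectedTemperoid X tf hZ hP NH A₀ hA₀ hA₀').galoisSurj R.AN.base
      R.αData.isGalois (ιX y)).hom (ModelFrobenioid.div R.pair.den) = ModelFrobenioid.div R.pair.den)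

/-- **The hlift law at the genuine level-`N` data from the pin `hPpre`** (abc-iut-w4-d042's generic `ThetaSubquotient.exists_lift_of_rho_mem_autPre`
— its `R`-level instance fixes the universe of `Λ`, here `Λ := μ_N` — + the dictionary
`qN_ιX_mem_range_iff`): an element `ρ k ∈ P.pre (B_N^bs)`, `k ∈ Π^tp_Ÿ`, has a representative `k₁ ∈ Π^tp_Ÿ ∩ l·Δ_Θ` with `ρ k₁ = ρ k`, provided
`ιX⁻¹(Stab x) ≤ Π^tp_Ÿ` (`hH`; for `A_⊙^bs := Ÿ` this is abc-iut-w4-d042's `stabilizer_base_comap_le_PiYdd` — print: `B_N` is a covering of `Ÿ`,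
§5 p.330).  [cite: MochizukiEtTh2009, Prop 5.5 proof p.327–328 (PDF pp.101–102); §5 p.330 (PDF p.104)] -/
theorem hlift_levelStub_of_pin_galois [RD.iotaN.range.Normal]
    {Gal : ConnectedPart (BTemp X.Pi) → Prop}
    (P : ThetaSubquotientProjGalois (ofConnectedTemperoidData h (RD.levelStub ιX) odd_l R ιX K' constEmb constEmb_injective hinvc hinvp) Gal)
    (hPpre : P.pre R.BN.base =
      (ThetaSubquotient.autPre (RD.qN ιX) RD.iotaN R.BN.base.obj).comap (Functor.mapAut R.BN.base (connectedObjects (BTemp X.Pi)).ι))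
    (hH : (stabilizerSubgroup R.BN.base.obj ((BiKummerSetting.NthRoot.baseIso _ R).hom.hom.hom.hom
        (galoisBase X.isTempered R.AN.base.obj R.αData.isGalois))).comap ιX.toMonoidHom ≤ RD.PiYdd)
    (k : RD.PiYdd) (hk : rhoOfBiKummerData R ιX k ∈ P.pre R.BN.base) :
    ∃ k₁ : RD.PiYdd, ((MulEquiv.refl RD.PiX) k₁ : RD.PiX) ∈ RD.lDeltaTheta ∧
      rhoOfBiKummerData R ιX k₁ = rhoOfBiKummerData R ιX k := by
  have hm : ((Functor.mapAut R.BN.base (connectedObjects (BTemp X.Pi)).ι).comp (rhoOfBiKummerData R ιX)) k ∈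
      ThetaSubquotient.autPre (RD.qN ιX) RD.iotaN R.BN.base.obj := by
    rw [hPpre] at hk
    exact hk
  -- abc-iut-w4-d042's generic hlift shape (its `R`-level instance fixes the universe of `Λ`; `Λ := μ_N` here)
  obtain ⟨k₁, hk₁, hq, he⟩ := ThetaSubquotient.exists_lift_of_rho_mem_autPre (RD.qN ιX) RD.iotaN
    ((BiKummerSetting.NthRoot.baseIso _ R).hom.hom.hom.hom (galoisBase X.isTempered R.AN.base.obj R.αData.isGalois))
    ιX.toMonoidHom ((Functor.mapAut R.BN.base (connectedObjects (BTemp X.Pi)).ι).comp (rhoOfBiKummerData R ιX))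
    (rhoOfBiKummerData_obj_apply_base R ιX) R.BN.base.property ιX.surjective RD.PiYdd hH k.2 hm
  refine ⟨⟨k₁, hk₁⟩, (RD.qN_ιX_mem_range_iff ιX k₁).1 hq, ?_⟩
  -- `mapAut` is injective on `Aut_D(B_N^bs)` (fully faithful inclusion)
  apply Iso.ext
  apply ObjectProperty.hom_ext
  exact congrArg Iso.hom he

set_option maxHeartbeats 400000 in
/-- **(J2η) AT THE GENUINE LEVEL-`N` DATA for `γ_Δ := φΛ`, `γ := ιX⁻¹ φ ιX`, `ι := id`**: from the pin `hPpre`, `hH` (`ιX⁻¹(Stab x) ≤ Π^tp_Ÿ`), the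
Prop. 5.2 (iii) pin `ThetaSectionCompat`, `η ∈ RD.thetaCocycles`, the level-`N` descent `hq`/`hι` of the [SemiAnbd] Prop. 3.2 datum `φ` of `Ψ^bs`,
Cor. 2.18 (i), and the shadow law of the (C)-chain.  Conclusion: VERBATIM the hypothesis `hγΔ` of `psiAut_symm_eq_of_rigidity` (p458989) at these data
(`γ x := ιX⁻¹ (φ (ιX x))`, `hγ := RigidData.symm_apply_apply_mem_PiYdd_of_cor218i …`).
[cite: MochizukiEtTh2009, Thm 5.7 proof p.330 (PDF p.104); Thm 5.6 proof p.329 (PDF p.103); Cor 2.18 (i) p.60] -/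
theorem gammaDelta_eta_levelStub_of_pin_galois [RD.iotaN.range.Normal]
    {Gal : ConnectedPart (BTemp X.Pi) → Prop}
    (P : ThetaSubquotientProjGalois (ofConnectedTemperoidData h (RD.levelStub ιX) odd_l R ιX K' constEmb constEmb_injective hinvc hinvp) Gal)
    (hPpre : P.pre R.BN.base =
      (ThetaSubquotient.autPre (RD.qN ιX) RD.iotaN R.BN.base.obj).comap (Functor.mapAut R.BN.base (connectedObjects (BTemp X.Pi)).ι))
    (hH : (stabilizerSubgroup R.BN.base.obj ((BiKummerSetting.NthRoot.baseIso _ R).hom.hom.hom.hom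
        (galoisBase X.isTempered R.AN.base.obj R.αData.isGalois))).comap ιX.toMonoidHom ≤ RD.PiYdd)
    (HF : (ofConnectedTemperoidData h (RD.levelStub ιX) odd_l R ιX K' constEmb constEmb_injective hinvc hinvp).Facts)
    (m : (ofConnectedTemperoidData h (RD.levelStub ιX) odd_l R ιX K' constEmb constEmb_injective hinvc hinvp).muTorsion
      (ofConnectedTemperoidData h (RD.levelStub ιX) odd_l R ιX K' constEmb constEmb_injective hinvc hinvp).BN
      (ofConnectedTemperoidData h (RD.levelStub ιX) odd_l R ιX K' constEmb constEmb_injective hinvc hinvp).N ≃* RD.mu)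
    (hι : (ofConnectedTemperoidData h (RD.levelStub ιX) odd_l R ιX K' constEmb constEmb_injective hinvc hinvp).IdentifiesPiYdd
      RD.toThetaEnvData (MulEquiv.refl _))
    {η : RD.PiYdd → RD.mu} (hη : η ∈ RD.thetaCocycles)
    (hpin : (ofConnectedTemperoidData h (RD.levelStub ιX) odd_l R ιX K' constEmb constEmb_injective hinvc hinvp).ThetaSectionCompat
      HF RD.toThetaEnvData (MulEquiv.refl _) m hι η)
    (θ' : Aut R.BN.base ≃* Aut R.BN.base) (φ : X.Pi ≃ₜ* X.Pi) (φQ : RD.LevelQuot ≃* RD.LevelQuot) (φΛ : RD.mu ≃* RD.mu)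
    (hq : ∀ g : X.Pi, RD.qN ιX (φ g) = φQ (RD.qN ιX g)) (hιN : ∀ a : RD.mu, RD.iotaN (φΛ a) = φQ (RD.iotaN a))
    (h218i : RD.Cor218_i)
    (hshadow : ∀ k : RD.PiYdd, θ' (rhoOfBiKummerData R ιX k) = rhoOfBiKummerData R ιX (ιX.symm (φ (ιX k)))) :
    ∀ k : (ofConnectedTemperoidData h (RD.levelStub ιX) odd_l R ιX K' constEmb constEmb_injective hinvc hinvp).PiYdd,
      (ofConnectedTemperoidData h (RD.levelStub ιX) odd_l R ιX K' constEmb constEmb_injective hinvc hinvp).ρ k ∈ P.pre R.BN.base →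
        φΛ (η ⟨MulEquiv.refl (ofConnectedTemperoidData h (RD.levelStub ιX) odd_l R ιX K' constEmb constEmb_injective hinvc hinvp).PiX k,
            (hι k).mp k.2⟩) =
          η ⟨ιX.symm (φ (ιX
              (MulEquiv.refl (ofConnectedTemperoidData h (RD.levelStub ιX) odd_l R ιX K' constEmb constEmb_injective hinvc hinvp).PiX k))),
            RD.symm_apply_apply_mem_PiYdd_of_cor218i ιX h218i φ _ ((hι k).mp k.2)⟩ :=
  gammaDelta_eta_of_lift_galois HF RD (MulEquiv.refl _) m hι hη hpin
    (hlift_levelStub_of_pin_galois h odd_l R ιX K' constEmb constEmb_injective hinvc hinvp P hPpre hH) θ'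
    (fun x => ιX.symm (φ (ιX x))) (RD.symm_apply_apply_mem_PiYdd_of_cor218i ιX h218i φ) hshadow φΛ
    (RD.thetaMod_transport_of_cor218i ιX h218i φ φQ φΛ hq hιN)

end LevelN

end ThetaFrobenioid

end Literature.AnabelianGeometry.EtaleTheta

end
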